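import Literature.NumberTheory.Transcendental.KZProduct
import Literature.Probability.RandomMatrix.TwoQubitSeparabilityVolumesRebitFibreSections
import Literature.Probability.RandomMatrix.LovasAndaiLemma6
import Literature.Probability.RandomMatrix.TwoQubitSeparabilityVolumesRebitFullProofs

/-!
# Lovas–Andai 2017 on the maximally mixed fibre — reduction to the eigenvalue integral (part 3)

Towards `LovasAndai2017_rebit_fibre_separability_probability_holds`
(`Literature/Probability/RandomMatrix/TwoQubitSeparabilityVolumes.lean`). Building on the
`Z`-section volumes (`TwoQubitSeparabilityVolumesRebitFibreSections.lean`), this file proves: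

* `lovasAndaiChiOne_inv` — the reciprocal symmetry `χ₁(1/ε) = χ₁(ε)` (Lovas–Andai, remark after
  Definition 1), via the entry transposition and `twiceOpNorm_swap` of `LovasAndaiLemma6Norm`;
* `posDef_blocks_of_posDef_rebitFibreMatrix` — `ρ ≻ 0 ⇒ 0 ≺ X ≺ ½` (sections are empty elsewhere);
* `volume_eq_lintegral_sections` — Fubini over `ℝ⁷ = ℝ³ × ℝ⁴` (`KZ.appendMeasurableEquiv 3 4`);
* `posDef_blocks_iff_eigen` — `0 ≺ X ≺ ½ ⟺ 0 < s̄ − r ∧ s̄ + r < ½` for the eigenvalues `s̄ ± r` of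
  `X = [[x₀, x₂], [x₂, x₁]]`, `s̄ = (x₀+x₁)/2`, `r = √(((x₀−x₁)/2)² + x₂²)`;
* `volume_posDef_rebitFibre_eq_lintegral`, `volume_posDef_and_rebitFibre_eq_lintegral` — the two
  volumes of the fact as integrals over `X ∈ ℝ³` of
  `𝟙[0 < s̄−r, s̄+r < ½] · det X det(½ − X) · χ₁(1)` resp. `· χ₁(√(b(½−a)/(a(½−b))))`,
  `a = s̄ + r`, `b = s̄ − r` — Lovas–Andai's `Vol(𝒟_{4,ℝ}(D)) = χ₁(1)·(…)` and
  `Vol(𝒟ˢ_{4,ℝ}(D)) = ∫ χ₁∘σ(…)` at `D = ½·1` [LovasAndai2017, Theorem 1 and proof of Corollary 2],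
  before passing to polar (eigenvalue) coordinates on `X`.

## References

* [LovasAndai2017] A. Lovas, A. Andai, J. Phys. A 50 (2017) 295303, Definition 1, Theorem 1,
  Corollary 2. arXiv:1610.01410.
-/

noncomputable section

open MeasureTheory Set Matrix
open scoped ENNReal Matrix

namespace Literature.Probability.RandomMatrix.LovasAndai

open Literature.Probability.RandomMatrix

/-- The coordinate swap `z ↦ (z₀, z₂, z₁, z₃)` (transposition of `2 × 2` matrices on entries)
preserves Lebesgue measure. [folklore] -/
theorem measurePreserving_transposeEntries :
    MeasurePreserving (fun z : Fin 4 → ℝ => (![z 0, z 2, z 1, z 3] : Fin 4 → ℝ)) volume volume := by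
  have h := volume_measurePreserving_piCongrLeft (fun _ : Fin 4 => ℝ) (Equiv.swap (1 : Fin 4) 2)
  convert h using 1
  funext z
  ext i
  fin_cases i <;>
    simp [MeasurableEquiv.piCongrLeft, Equiv.piCongrLeft_apply_eq_cast,
      Equiv.swap_apply_of_ne_of_ne, Equiv.swap_apply_left, Equiv.swap_apply_right]

/-- **Reciprocal symmetry of Lovas–Andai's `χ₁`**: `χ₁(1/ε) = χ₁(ε)` ("these functions are
reciprocal symmetric", after Definition 1 of [LovasAndai2017]): on entries, conjugating by
`V_{1/ε}` is transposing, conjugating by `V_ε`, and transposing back, and the operator norm is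
transpose invariant (`twiceOpNorm_swap`).
[cite: LovasAndai2017, Definition 1 (reciprocal symmetry)] -/
theorem lovasAndaiChiOne_inv (ε : ℝ) : lovasAndaiChiOne ε⁻¹ = lovasAndaiChiOne ε := by
  rw [LovasAndaiLemma6.lovasAndaiChiOne_eq_volume_normSet,
    LovasAndaiLemma6.lovasAndaiChiOne_eq_volume_normSet]
  have hset : (fun z : Fin 4 → ℝ => (![z 0, z 2, z 1, z 3] : Fin 4 → ℝ)) ⁻¹'
      LovasAndaiLemma6.normSet ε⁻¹ = LovasAndaiLemma6.normSet ε := by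
    ext z
    simp only [LovasAndaiLemma6.normSet, mem_preimage, mem_setOf_eq, Matrix.cons_val_zero,
      Matrix.cons_val_one, Matrix.cons_val]
    rw [LovasAndaiLemma6.twiceOpNorm_swap (z 0) (z 1) (z 2) (z 3),
      ← LovasAndaiLemma6.twiceOpNorm_swap (z 0) (ε⁻¹ * z 2) (z 1 / ε⁻¹) (z 3),
      show z 1 / ε⁻¹ = ε * z 1 by rw [div_eq_mul_inv, inv_inv, mul_comm],
      show ε⁻¹ * z 2 = z 2 / ε by rw [div_eq_mul_inv, mul_comm]]
  rw [← hset]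
  exact (measurePreserving_transposeEntries.measure_preimage
    (LovasAndaiLemma6.measurableSet_normSet ε⁻¹).nullMeasurableSet).symm

/-! ### Empty sections away from `0 ≺ X ≺ ½` -/

/-- If `ρ(x) ≻ 0` on the fibre chart then `0 ≺ X ≺ ½·1` (`X ≻ 0` is part of the Schur criterion, and
`½ − X = (½ − X − ZᵀX⁻¹Z) + ZᵀX⁻¹Z` with the first summand `≻ 0` and the second `⪰ 0`).
[cite: LovasAndai2017, proof of Theorem 1] -/
theorem posDef_blocks_of_posDef_rebitFibreMatrix {x : Fin 7 → ℝ} (h : (rebitFibreMatrix x).PosDef) :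
    (!![x 0, x 2; x 2, x 1] : Matrix (Fin 2) (Fin 2) ℝ).PosDef ∧
      (!![1 / 2 - x 0, -x 2; -x 2, 1 / 2 - x 1] : Matrix (Fin 2) (Fin 2) ℝ).PosDef := by
  rw [posDef_rebitFibreMatrix_iff] at h
  refine ⟨h.1, ?_⟩
  have hpsd : ((!![x 3, x 4; x 5, x 6] : Matrix (Fin 2) (Fin 2) ℝ)ᵀ * (!![x 0, x 2; x 2, x 1])⁻¹ *
      !![x 3, x 4; x 5, x 6]).PosSemidef := by
    have := h.1.inv.posSemidef.conjTranspose_mul_mul_same (!![x 3, x 4; x 5, x 6])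
    rwa [Matrix.conjTranspose_eq_transpose_of_trivial] at this
  have := h.2.add_posSemidef hpsd
  rwa [sub_add_cancel] at this

/-! ### Fubini over `ℝ⁷ = ℝ³ × ℝ⁴` -/

/-- Measurability of `{x : ρ(x) ≻ 0}` on the fibre chart. [folklore] -/
theorem measurableSet_posDef_rebitFibre :
    MeasurableSet {x : Fin 7 → ℝ | (rebitFibreMatrix x).PosDef} :=
  (LovasAndai2017.isOpen_setOf_posDef LovasAndai2017.continuous_rebitFibreMatrix
    LovasAndai2017.isHermitian_rebitFibreMatrix).measurableSet

/-- For a measurable `S ⊆ ℝ⁷`: `vol S = ∫_{x' ∈ ℝ³} vol{z ∈ ℝ⁴ : (x', z) ∈ S} dx'`. [folklore] -/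
theorem volume_eq_lintegral_sections {S : Set (Fin 7 → ℝ)} (hS : MeasurableSet S) :
    volume S = ∫⁻ x' : Fin 3 → ℝ, volume {z : Fin 4 → ℝ | Fin.append x' z ∈ S} := by
  have e := Literature.NumberTheory.Transcendental.KZ.volume_preserving_appendMeasurableEquiv
    (n := 3) (m := 4)
  have hmeas : MeasurableSet
      (Literature.NumberTheory.Transcendental.KZ.appendMeasurableEquiv 3 4 ⁻¹' S) :=
    (Literature.NumberTheory.Transcendental.KZ.appendMeasurableEquiv 3 4).measurable hS
  rw [← e.map_eq, MeasurableEquiv.map_apply, Measure.volume_eq_prod, Measure.prod_apply hmeas]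
  refine lintegral_congr fun x' => ?_
  congr 1
  ext z
  simp only [mem_preimage, mem_setOf_eq,
    Literature.NumberTheory.Transcendental.KZ.appendMeasurableEquiv_apply]

/-! ### The two volumes as integrals over `X ∈ ℝ³` of explicit functions of the eigenvalues -/

/-- Elementary: the eigenvalue bounds `0 < s̄ − r`, `s̄ + r < ½` (`s̄ = (x₀+x₁)/2`,
`r = √(((x₀−x₁)/2)² + x₂²)`) are exactly `0 ≺ X ≺ ½·1` for `X = [[x₀, x₂], [x₂, x₁]]`. [folklore] -/
theorem posDef_blocks_iff_eigen (x' : Fin 3 → ℝ) :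
    ((!![x' 0, x' 2; x' 2, x' 1] : Matrix (Fin 2) (Fin 2) ℝ).PosDef ∧
      (!![1 / 2 - x' 0, -x' 2; -x' 2, 1 / 2 - x' 1] : Matrix (Fin 2) (Fin 2) ℝ).PosDef) ↔
    (0 < (x' 0 + x' 1) / 2 - Real.sqrt (((x' 0 - x' 1) / 2) ^ 2 + x' 2 ^ 2) ∧
      (x' 0 + x' 1) / 2 + Real.sqrt (((x' 0 - x' 1) / 2) ^ 2 + x' 2 ^ 2) < 1 / 2) := by
  set r := Real.sqrt (((x' 0 - x' 1) / 2) ^ 2 + x' 2 ^ 2) with hr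
  have hr0 : 0 ≤ r := Real.sqrt_nonneg _
  have hr2 : r ^ 2 = ((x' 0 - x' 1) / 2) ^ 2 + x' 2 ^ 2 := Real.sq_sqrt (by positivity)
  have hH1 : (!![x' 0, x' 2; x' 2, x' 1] : Matrix (Fin 2) (Fin 2) ℝ).IsHermitian := by
    rw [Matrix.IsHermitian, Matrix.conjTranspose_eq_transpose_of_trivial]
    ext i j; fin_cases i <;> fin_cases j <;> rfl
  have hH2 :
      (!![1 / 2 - x' 0, -x' 2; -x' 2, 1 / 2 - x' 1] : Matrix (Fin 2) (Fin 2) ℝ).IsHermitian := by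
    rw [Matrix.IsHermitian, Matrix.conjTranspose_eq_transpose_of_trivial]
    ext i j; fin_cases i <;> fin_cases j <;> rfl
  rw [posDef_fin_two_iff hH1, posDef_fin_two_iff hH2]
  simp only [Matrix.trace_fin_two, Matrix.det_fin_two, Matrix.of_apply, Matrix.cons_val',
    Matrix.cons_val_zero, Matrix.cons_val_one, Matrix.empty_val', Matrix.cons_val_fin_one]
  constructor
  · rintro ⟨⟨h1, h2⟩, ⟨h3, h4⟩⟩
    constructor
    · -- s̄ > r ⟸ s̄ > 0 ∧ s̄² − r² = det > 0
      have hdet : ((x' 0 + x' 1) / 2) ^ 2 - r ^ 2 = x' 0 * x' 1 - x' 2 * x' 2 := by rw [hr2]; ring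
      nlinarith
    · have hdet : (1 / 2 - (x' 0 + x' 1) / 2) ^ 2 - r ^ 2 =
          (1 / 2 - x' 0) * (1 / 2 - x' 1) - -x' 2 * -x' 2 := by rw [hr2]; ring
      nlinarith
  · rintro ⟨h1, h2⟩
    refine ⟨⟨by linarith, ?_⟩, ⟨by linarith, ?_⟩⟩
    · have hdet : x' 0 * x' 1 - x' 2 * x' 2 =
          ((x' 0 + x' 1) / 2 - r) * ((x' 0 + x' 1) / 2 + r) := by
        rw [show ((x' 0 + x' 1) / 2 - r) * ((x' 0 + x' 1) / 2 + r) =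
            ((x' 0 + x' 1) / 2) ^ 2 - r ^ 2 by ring,
          hr2]; ring
      rw [hdet]
      exact mul_pos h1 (by linarith)
    · have hdet : (1 / 2 - x' 0) * (1 / 2 - x' 1) - -x' 2 * -x' 2 =
          (1 / 2 - (x' 0 + x' 1) / 2 - r) * (1 / 2 - (x' 0 + x' 1) / 2 + r) := by
        rw [show (1 / 2 - (x' 0 + x' 1) / 2 - r) * (1 / 2 - (x' 0 + x' 1) / 2 + r) =
          (1 / 2 - (x' 0 + x' 1) / 2) ^ 2 - r ^ 2 by ring, hr2]; ring
      rw [hdet]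
      exact mul_pos (by linarith) (by linarith)

/-- **The volume of `{ρ ≻ 0}` over the eigenvalue data.**
`vol₇{ρ ≻ 0} = ∫_{ℝ³} 𝟙[0 < s̄−r, s̄+r < ½] · det X det(½−X) · χ₁(1) dx` (`X = [[x₀,x₂],[x₂,x₁]]`).
[cite: LovasAndai2017, proof of Corollary 2 ("In a similar way, we can calculate the volume of
the whole space")] -/
theorem volume_posDef_rebitFibre_eq_lintegral :
    volume {x : Fin 7 → ℝ | (rebitFibreMatrix x).PosDef} =
      ∫⁻ x' : Fin 3 → ℝ,
        (if 0 < (x' 0 + x' 1) / 2 - Real.sqrt (((x' 0 - x' 1) / 2) ^ 2 + x' 2 ^ 2) ∧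
          (x' 0 + x' 1) / 2 + Real.sqrt (((x' 0 - x' 1) / 2) ^ 2 + x' 2 ^ 2) < 1 / 2 then
        ENNReal.ofReal ((x' 0 * x' 1 - x' 2 ^ 2) * ((1 / 2 - x' 0) * (1 / 2 - x' 1) - x' 2 ^ 2)) *
          lovasAndaiChiOne 1 else 0) := by
  rw [volume_eq_lintegral_sections measurableSet_posDef_rebitFibre]
  refine lintegral_congr fun x' => ?_
  simp only [mem_setOf_eq]
  by_cases hc : ((!![x' 0, x' 2; x' 2, x' 1] : Matrix (Fin 2) (Fin 2) ℝ).PosDef ∧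
      (!![1 / 2 - x' 0, -x' 2; -x' 2, 1 / 2 - x' 1] : Matrix (Fin 2) (Fin 2) ℝ).PosDef)
  · rw [if_pos ((posDef_blocks_iff_eigen x').mp hc)]
    obtain ⟨ε, l₀, l₁, -, -, -, -, -, -, -, -, hv, -⟩ := fibre_sections hc.1 hc.2
    exact hv
  · rw [if_neg (fun h => hc ((posDef_blocks_iff_eigen x').mpr h))]
    have : {z : Fin 4 → ℝ | (rebitFibreMatrix (Fin.append x' z)).PosDef} = ∅ := by
      ext z
      simp only [mem_setOf_eq, mem_empty_iff_false, iff_false]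
      intro hz
      have h := posDef_blocks_of_posDef_rebitFibreMatrix hz
      exact hc h
    rw [this, measure_empty]

/-- Measurability of `{x : 0 ≺ ρ(x) ≺ ½·1}` on the fibre chart. [folklore] -/
theorem measurableSet_posDef_and_rebitFibre :
    MeasurableSet {x : Fin 7 → ℝ | (rebitFibreMatrix x).PosDef ∧
      ((2 : ℝ)⁻¹ • (1 : Matrix (Fin 4) (Fin 4) ℝ) - rebitFibreMatrix x).PosDef} := by
  refine measurableSet_posDef_rebitFibre.inter ?_
  refine (LovasAndai2017.isOpen_setOf_posDef
    (continuous_const.sub LovasAndai2017.continuous_rebitFibreMatrix) fun x => ?_).measurableSet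
  refine Matrix.IsHermitian.sub ?_ (LovasAndai2017.isHermitian_rebitFibreMatrix x)
  rw [Matrix.smul_one_eq_diagonal]
  exact Matrix.isHermitian_diagonal_of_self_adjoint _ (funext fun _ => by simp)

/-- **The volume of `{0 ≺ ρ ≺ ½·1}` over the eigenvalue data.** With `a = s̄ + r ≥ b = s̄ − r` the
eigenvalues of `X`:
`vol₇{0 ≺ ρ ≺ ½} = ∫_{ℝ³} 𝟙[0 < b, a < ½] · det X det(½−X) · χ₁(√(b(½−a)/(a(½−b)))) dx`.
[cite: LovasAndai2017, Theorem 1 (proof) and Corollary 2] -/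
theorem volume_posDef_and_rebitFibre_eq_lintegral :
    volume {x : Fin 7 → ℝ | (rebitFibreMatrix x).PosDef ∧
      ((2 : ℝ)⁻¹ • (1 : Matrix (Fin 4) (Fin 4) ℝ) - rebitFibreMatrix x).PosDef} =
      ∫⁻ x' : Fin 3 → ℝ,
        (if 0 < (x' 0 + x' 1) / 2 - Real.sqrt (((x' 0 - x' 1) / 2) ^ 2 + x' 2 ^ 2) ∧
          (x' 0 + x' 1) / 2 + Real.sqrt (((x' 0 - x' 1) / 2) ^ 2 + x' 2 ^ 2) < 1 / 2 then
        ENNReal.ofReal ((x' 0 * x' 1 - x' 2 ^ 2) * ((1 / 2 - x' 0) * (1 / 2 - x' 1) - x' 2 ^ 2)) *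
          lovasAndaiChiOne (Real.sqrt (
            ((x' 0 + x' 1) / 2 - Real.sqrt (((x' 0 - x' 1) / 2) ^ 2 + x' 2 ^ 2)) *
              (1 / 2 - ((x' 0 + x' 1) / 2 + Real.sqrt (((x' 0 - x' 1) / 2) ^ 2 + x' 2 ^ 2))) /
            (((x' 0 + x' 1) / 2 + Real.sqrt (((x' 0 - x' 1) / 2) ^ 2 + x' 2 ^ 2)) *
              (1 / 2 - ((x' 0 + x' 1) / 2 - Real.sqrt (((x' 0 - x' 1) / 2) ^ 2 + x' 2 ^ 2))))))
        else 0) := by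
  rw [volume_eq_lintegral_sections measurableSet_posDef_and_rebitFibre]
  refine lintegral_congr fun x' => ?_
  simp only [mem_setOf_eq]
  set sbar := (x' 0 + x' 1) / 2 with hsbar
  set r := Real.sqrt (((x' 0 - x' 1) / 2) ^ 2 + x' 2 ^ 2) with hr
  have hr0 : 0 ≤ r := Real.sqrt_nonneg _
  have hr2 : r ^ 2 = ((x' 0 - x' 1) / 2) ^ 2 + x' 2 ^ 2 := Real.sq_sqrt (by positivity)
  by_cases hc : ((!![x' 0, x' 2; x' 2, x' 1] : Matrix (Fin 2) (Fin 2) ℝ).PosDef ∧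
      (!![1 / 2 - x' 0, -x' 2; -x' 2, 1 / 2 - x' 1] : Matrix (Fin 2) (Fin 2) ℝ).PosDef)
  · have hab := (posDef_blocks_iff_eigen x').mp hc
    rw [if_pos hab]
    obtain ⟨ε, l₀, l₁, hε, hl₀, hl₀', hl₁, hl₁', hsum, hprod, hε2, -, hv⟩ :=
      fibre_sections hc.1 hc.2
    rw [hv]
    congr 1
    -- identify `{l₀, l₁} = {s̄ + r, s̄ − r}` and use the reciprocal symmetry
    have hsum' : l₀ + l₁ = (sbar + r) + (sbar - r) := by rw [hsum, hsbar]; ring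
    have hprod' : l₀ * l₁ = (sbar + r) * (sbar - r) := by
      rw [hprod, show (sbar + r) * (sbar - r) = sbar ^ 2 - r ^ 2 by ring, hr2, hsbar]; ring
    have hroot : (l₀ - (sbar + r)) * (l₀ - (sbar - r)) = 0 := by nlinarith [hsum', hprod']
    have hb0 : 0 < sbar - r := hab.1
    have ha0 : 0 < sbar + r := by linarith
    have ha' : sbar + r < 1 / 2 := hab.2
    have hb' : sbar - r < 1 / 2 := by linarith
    set ε₀ := Real.sqrt ((sbar - r) * (1 / 2 - (sbar + r)) / ((sbar + r) * (1 / 2 - (sbar - r))))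
      with hε₀
    have hq : 0 < (sbar - r) * (1 / 2 - (sbar + r)) / ((sbar + r) * (1 / 2 - (sbar - r))) := by
      apply div_pos <;> apply mul_pos <;> linarith
    have hε₀pos : 0 < ε₀ := Real.sqrt_pos.mpr hq
    have hε₀2 : ε₀ ^ 2 = (sbar - r) * (1 / 2 - (sbar + r)) / ((sbar + r) * (1 / 2 - (sbar - r))) :=
      Real.sq_sqrt hq.le
    rcases mul_eq_zero.mp hroot with h | h
    · -- l₀ = s̄ + r, l₁ = s̄ − r, ε = 1/ε₀
      have hl0 : l₀ = sbar + r := by linarith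
      have hl1 : l₁ = sbar - r := by linarith
      have hεinv : ε = ε₀⁻¹ := by
        have h2 : ε ^ 2 = (ε₀⁻¹) ^ 2 := by
          rw [hε2, hl0, hl1, inv_pow, hε₀2]
          field_simp
        exact (sq_eq_sq₀ hε.le (inv_nonneg.mpr hε₀pos.le)).mp h2
      rw [hεinv, lovasAndaiChiOne_inv]
    · have hl0 : l₀ = sbar - r := by linarith
      have hl1 : l₁ = sbar + r := by linarith
      have hεeq : ε = ε₀ := by
        have h2 : ε ^ 2 = ε₀ ^ 2 := by rw [hε2, hl0, hl1, hε₀2]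
        exact (sq_eq_sq₀ hε.le hε₀pos.le).mp h2
      rw [hεeq]
  · rw [if_neg (fun h => hc ((posDef_blocks_iff_eigen x').mpr h))]
    have : {z : Fin 4 → ℝ | (rebitFibreMatrix (Fin.append x' z)).PosDef ∧
        ((2 : ℝ)⁻¹ • (1 : Matrix (Fin 4) (Fin 4) ℝ) -
          rebitFibreMatrix (Fin.append x' z)).PosDef} = ∅ := by
      ext z
      simp only [mem_setOf_eq, mem_empty_iff_false, iff_false, not_and]
      intro hz _
      exact hc (posDef_blocks_of_posDef_rebitFibreMatrix hz)
    rw [this, measure_empty]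

end Literature.Probability.RandomMatrix.LovasAndai

end
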